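import Summits.ResolutionOfSingularities.ResolutionOfSingularities.Theorems.FrobeniusLadderFRationalResolutionOneSopQuotient
import Summits.ResolutionOfSingularities.ResolutionOfSingularities.Theorems.FrobeniusLadderFRationalResolutionStubClauseOfRingEquiv
import HarnessLib

/-!
# One tightly closed parameter ideal suffices — for every ring presented as `S ⧸ Q`

Support file for crux stmt-ResolutionOfSingularities-15317 (`FrobeniusLadder.FRationalResolution`),
line `Sketch`, continuation seat c3, cycle 5 (theme: Hochster–Huneke 1994 Prop. 6.27 (a) at the
level of STALKS). The landed `fRationalClause_of_one_quotient` (file `…OneSopQuotient.lean`,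
p151811) says: for `S` a regular local ring of characteristic `p` and `Q` a prime ideal, if ONE
ideal of `S ⧸ Q` generated by a full system of parameters is tightly closed then every such ideal
is — the F-rational clause of the crux. Here the statement is transported to any ring `R` given
together with a ring isomorphism `e : R ≃+* S ⧸ Q` (the shape in which the stalks of `k`-schemes
locally of finite type present themselves, `exists_stalk_ringEquiv_quotient`): the one-ideal datum
is pushed forward along `e` (`ClauseInvariance.span_range_symm_comp`,
`ClauseInvariance.symm_mem_span_pow_image`), the quotient theorem is applied in `S ⧸ Q`, and the
full clause is pulled back by `ClauseInvariance.stub_clause_of_ringEquiv`.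
[cite: HochsterHuneke1994, Prop. 6.27 (a)] (special case: homomorphic images of regular local rings)
-/

-- single-problem summit: the doubled namespace component is forced
set_option linter.dupNamespace false

noncomputable section

namespace Summit.ResolutionOfSingularities.ResolutionOfSingularities.Theorems.FRationalResolution

open IsLocalRing Literature.RingTheory.TightClosure ClauseInvariance

/-- **One tightly closed parameter ideal suffices, for rings isomorphic to `S ⧸ Q`** (`S` regular
local of characteristic `p`, `Q` prime). If `e : R ≃+* S ⧸ Q` and ONE ideal of `R` generated by
`d₀ = dim R` elements with maximal radical is tightly closed (inline form), then `R` is a domain and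
EVERY ideal generated by a full system of parameters of `R` is tightly closed — the F-rational
clause of crux `FRationalResolution` at `R`. [cite: HochsterHuneke1994, Prop. 6.27 (a)] -/
theorem fRationalClause_of_one_of_ringEquiv_quotient (p : ℕ) [Fact p.Prime] {R S : Type}
    [CommRing R] [CommRing S] [IsRegularLocalRing S] [CharP S p] (Q : Ideal S) [Q.IsPrime]
    [IsLocalRing (S ⧸ Q)] (e : R ≃+* S ⧸ Q) {d₀ : ℕ} (hd₀ : ringKrullDim R = d₀) (s₀ : Fin d₀ → R)
    (hs₀ : (Ideal.span (Set.range s₀)).radical.IsMaximal)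
    (htc₀ : ∀ y c : R, c ≠ 0 → (∀ e : ℕ, c * y ^ p ^ e ∈
      Ideal.span ((fun z : R => z ^ p ^ e) '' (Ideal.span (Set.range s₀) : Set R))) →
      y ∈ Ideal.span (Set.range s₀)) :
    IsDomain R ∧ ∀ d : ℕ, ringKrullDim R = d → ∀ s : Fin d → R,
      (Ideal.span (Set.range s)).radical.IsMaximal → ∀ y c : R, c ≠ 0 →
      (∀ e : ℕ, c * y ^ p ^ e ∈ Ideal.span ((fun z : R => z ^ p ^ e) ''
        (Ideal.span (Set.range s) : Set R))) → y ∈ Ideal.span (Set.range s) := by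
  -- `ψ = e⁻¹ : S ⧸ Q ≃+* R`
  set ψ : S ⧸ Q ≃+* R := e.symm with hψ
  have hψs : ψ.symm = e := by rw [hψ, RingEquiv.symm_symm]
  -- the pushed-forward one-ideal datum `e ∘ s₀`
  have hJ : Ideal.span (Set.range (e ∘ s₀)) = (Ideal.span (Set.range s₀)).comap ψ := by
    rw [← hψs]
    exact span_range_symm_comp ψ s₀
  have hJe : (Ideal.span (Set.range (e ∘ s₀))).comap e = Ideal.span (Set.range s₀) := by
    ext r
    rw [hJ, Ideal.mem_comap, Ideal.mem_comap, hψ]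
    exact (RingEquiv.symm_apply_apply e r).symm ▸ Iff.rfl
  have hdT : ringKrullDim (S ⧸ Q) = d₀ := (ringKrullDim_eq_of_ringEquiv e).symm.trans hd₀
  have hsT : (Ideal.span (Set.range (e ∘ s₀))).radical.IsMaximal := by
    rw [hJ, ← Ideal.comap_radical]
    exact Ideal.comap_isMaximal_of_equiv ψ
  have htcT : ∀ y c : S ⧸ Q, c ≠ 0 → (∀ n : ℕ, c * y ^ p ^ n ∈
      Ideal.span ((fun z : S ⧸ Q => z ^ p ^ n) ''
        (Ideal.span (Set.range (e ∘ s₀)) : Set (S ⧸ Q)))) →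
      y ∈ Ideal.span (Set.range (e ∘ s₀)) := by
    intro y c hc hmem
    have hcR : ψ c ≠ 0 := ψ.map_ne_zero_iff.mpr hc
    have hmemR : ∀ n : ℕ, ψ c * ψ y ^ p ^ n ∈
        Ideal.span ((fun z : R => z ^ p ^ n) '' (Ideal.span (Set.range s₀) : Set R)) := by
      intro n
      have h := symm_mem_span_pow_image e p n (Ideal.span (Set.range (e ∘ s₀))) (hmem n)
      rwa [hJe] at h
    have hyR : ψ y ∈ Ideal.span (Set.range s₀) := htc₀ (ψ y) (ψ c) hcR hmemR
    have hy : e (ψ y) ∈ Ideal.span (Set.range (e ∘ s₀)) := by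
      rw [hJ, Ideal.mem_comap, hψ]
      exact (RingEquiv.symm_apply_apply e (ψ y)).symm ▸ hyR
    rwa [hψ, RingEquiv.apply_symm_apply] at hy
  -- HH94 6.27 (a) for `S ⧸ Q`, then transport back along `ψ`
  have hT := fRationalClause_of_one_quotient p S Q hdT (e ∘ s₀) hsT htcT
  haveI : IsDomain S := Literature.AlgebraicGeometry.Resolution.isDomain_of_isRegularLocalRing S
  have hdomT : IsDomain (S ⧸ Q) := Ideal.Quotient.isDomain Q
  exact stub_clause_of_ringEquiv p ψ ⟨hdomT, hT⟩

end Summit.ResolutionOfSingularities.ResolutionOfSingularities.Theorems.FRationalResolution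

end
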